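import Literature.NumberTheory.LFunctions.RiemannXiProofs
import Literature.NumberTheory.LFunctions.SuzukiUncertaintyLemmaProofs
import Summits.RiemannHypothesis.RiemannHypothesis.Theorems.Splittings.EarlyAppointmentsXiWindowCounts

/-!
# EarlyAppointments — the Ξ ↔ ζ window dictionary (slot 11b; W-07 C6, cut of `ZetaWindowBudget` rev 5/6)
RH-FREE.  Nothing here bears on the truth of RH; RH is not proved.

`Σᶠ_{Ξ u = 0, a < Re u ≤ b} (analyticOrderAt Ξ u).toNat = N(b) − N(a)` for `0 ≤ a ≤ b` (`xiDictHalfOpen_holds`, ℝ-valued;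
`stub_L1c_holds`, ℕ-valued), via `riemannXi_eq_zero_iff_holds`, `SuzukiUncertainty.riemannZetaZeroOrder_eq_analyticOrderNatAt_riemannXi`
and the decomposition `zetaZeroBox 0 b = zetaZeroBox 0 a ∪ zetaWindow a b`; plus the three ε-fattened window shapes
`XiDictColumn/Right/Left` used by the budget assembly.
-/

set_option linter.dupNamespace false  -- D-0017: the mandated namespace `Summit.<S>.<S>.…` repeats `RiemannHypothesis`
namespace Summit.RiemannHypothesis.RiemannHypothesis.Theorems.Splittings.EarlyAppointmentsXiZetaDictionary

open Real Literature.NumberTheory.LFunctions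
open Summit.RiemannHypothesis.RiemannHypothesis.Theorems.Splittings.EarlyAppointmentsXiWindowCounts

/-- Ξ-zero multiplicity weight. -/
noncomputable def xiOrd (u : ℂ) : ℝ := ((analyticOrderAt riemannXiUpper u).toNat : ℝ)

/-- **THE ONE MISSING LEMMA of the budget conjuncts — the Ξ ↔ ζ COUNTING DICTIONARY, in the packet's three window shapes**
(all three follow from C3's half-open `stub_L1c` (l.4191) + finiteness of Ξ-zeros in bounded windows + monotonicity in the window;
`ε` handles the closed / left-closed endpoints without left limits of `N`). -/
def XiDictColumn : Prop :=
  ∀ x₀ r ε : ℝ, 0 ≤ r → 0 < ε → 0 ≤ x₀ - r - ε →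
    (∑ᶠ u ∈ {u : ℂ | riemannXiUpper u = 0 ∧ |u.re - x₀| ≤ r}, xiOrd u) ≤
      (zetaZeroCount (x₀ + r + ε) : ℝ) - zetaZeroCount (x₀ - r - ε)

/-- DICTIONARY, right half-slab shape `(x₀, x₀ + r]`: the `Ξ`-zero multiplicity count equals `N(x₀ + r) − N(x₀)` (`0 ≤ x₀`, `0 ≤ r`). -/
def XiDictRight : Prop :=
  ∀ x₀ r : ℝ, 0 ≤ x₀ → 0 ≤ r →
    (∑ᶠ u ∈ {u : ℂ | riemannXiUpper u = 0 ∧ x₀ < u.re ∧ u.re ≤ x₀ + r}, xiOrd u) =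
      (zetaZeroCount (x₀ + r) : ℝ) - zetaZeroCount x₀

/-- DICTIONARY, left half-slab shape `[x₀ − r, x₀)`: the `Ξ`-zero multiplicity count is squeezed between `N(x₀ − ε) − N(x₀ − r)` and `N(x₀) − N(x₀ − r − ε)`. -/
def XiDictLeft : Prop :=
  ∀ x₀ r ε : ℝ, 0 < ε → ε ≤ r → 0 ≤ x₀ - r - ε →
    (zetaZeroCount (x₀ - ε) : ℝ) - zetaZeroCount (x₀ - r) ≤
        (∑ᶠ u ∈ {u : ℂ | riemannXiUpper u = 0 ∧ x₀ - r ≤ u.re ∧ u.re < x₀}, xiOrd u) ∧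
    (∑ᶠ u ∈ {u : ℂ | riemannXiUpper u = 0 ∧ x₀ - r ≤ u.re ∧ u.re < x₀}, xiOrd u) ≤
        (zetaZeroCount x₀ : ℝ) - zetaZeroCount (x₀ - r - ε)

/-- C3's `stub_L1c` (l.4191), cast to `ℝ`: the half-open COUNTING DICTIONARY. -/
def XiDictHalfOpen : Prop :=
  ∀ a b : ℝ, 0 ≤ a → a ≤ b →
    (∑ᶠ u ∈ {u : ℂ | riemannXiUpper u = 0 ∧ a < u.re ∧ u.re ≤ b}, xiOrd u) =
      (zetaZeroCount b : ℝ) - zetaZeroCount a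

/-- Finiteness of the Ξ-zeros in a closed vertical window (standard: `RootsInStrip Ξ 1` + isolated zeros of a
non-trivial entire function; equivalently finiteness of the ζ-zeros with ordinate in `[a, b]`). -/
def XiZerosWindowFinite : Prop :=
  ∀ a b : ℝ, {u : ℂ | riemannXiUpper u = 0 ∧ a ≤ u.re ∧ u.re ≤ b}.Finite

/-- The multiplicity weight `xiOrd u` is nonnegative. -/
theorem xiOrd_nonneg (u : ℂ) : 0 ≤ xiOrd u := Nat.cast_nonneg _

/-- Monotonicity of `finsum_mem` in the set, for a nonnegative summand and a finite larger set. -/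
theorem finsum_mem_mono_set {α : Type*} {f : α → ℝ} {s t : Set α} (hst : s ⊆ t) (ht : t.Finite)
    (hf : ∀ a, 0 ≤ f a) : ∑ᶠ a ∈ s, f a ≤ ∑ᶠ a ∈ t, f a := by
  have hs : s.Finite := ht.subset hst
  have hd : Disjoint s (t \ s) := Set.disjoint_sdiff_right
  have hu : s ∪ (t \ s) = t := Set.union_sdiff_cancel hst
  have hts : (t \ s).Finite := ht.subset Set.sdiff_subset
  rw [← hu, finsum_mem_union hd hs hts]
  have h0 : 0 ≤ ∑ᶠ a ∈ t \ s, f a := by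
    rw [finsum_mem_def]
    exact finsum_nonneg fun a => Set.indicator_nonneg (fun _ _ => hf _) _
  linarith

/-- **The packet's three window shapes follow from the half-open dictionary + finiteness.** -/
theorem xiDict_of_halfOpen (hD : XiDictHalfOpen) (hF : XiZerosWindowFinite) :
    XiDictColumn ∧ XiDictRight ∧ XiDictLeft := by
  refine ⟨?_, ?_, ?_⟩
  · intro x₀ r ε hr hε hx
    have e := hD (x₀ - r - ε) (x₀ + r + ε) hx (by linarith)
    rw [← e]
    refine finsum_mem_mono_set ?_ ?_ xiOrd_nonneg
    · intro u hu
      simp only [Set.mem_setOf_eq] at hu ⊢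
      obtain ⟨h1, h2⟩ := hu
      obtain ⟨h3, h4⟩ := abs_le.1 h2
      exact ⟨h1, by linarith, by linarith⟩
    · refine (hF (x₀ - r - ε) (x₀ + r + ε)).subset ?_
      intro u hu
      simp only [Set.mem_setOf_eq] at hu ⊢
      exact ⟨hu.1, hu.2.1.le, hu.2.2⟩
  · intro x₀ r hx hr
    exact hD x₀ (x₀ + r) hx (by linarith)
  · intro x₀ r ε hε hεr hx
    constructor
    · have e := hD (x₀ - r) (x₀ - ε) (by linarith) (by linarith)
      rw [← e]
      refine finsum_mem_mono_set ?_ ?_ xiOrd_nonneg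
      · intro u hu
        simp only [Set.mem_setOf_eq] at hu ⊢
        obtain ⟨h1, h2, h3⟩ := hu
        exact ⟨h1, h2.le, by linarith⟩
      · refine (hF (x₀ - r) x₀).subset ?_
        intro u hu
        simp only [Set.mem_setOf_eq] at hu ⊢
        exact ⟨hu.1, hu.2.1, hu.2.2.le⟩
    · have e := hD (x₀ - r - ε) x₀ hx (by linarith)
      rw [← e]
      refine finsum_mem_mono_set ?_ ?_ xiOrd_nonneg
      · intro u hu
        simp only [Set.mem_setOf_eq] at hu ⊢
        obtain ⟨h1, h2, h3⟩ := hu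
        exact ⟨h1, by linarith, h3.le⟩
      · refine (hF (x₀ - r - ε) x₀).subset ?_
        intro u hu
        simp only [Set.mem_setOf_eq] at hu ⊢
        exact ⟨hu.1, hu.2.1.le, hu.2.2⟩

/-- **Window finiteness, PROVED** from the tree: Ξ-zeros ↔ ζ-zeros in the critical strip (`riemannXi_eq_zero_iff_holds`) and
discreteness of the ζ-zeros on compacta (`IsCompact.inter_riemannZetaZeros_finite`). -/
theorem xiZerosWindowFinite_holds : XiZerosWindowFinite := by
  intro a b
  have hK := ((isCompact_Icc (a := (0 : ℝ)) (b := 1)).reProdIm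
    (isCompact_Icc (a := a) (b := b))).inter_riemannZetaZeros_finite
  have hinj : Set.InjOn (fun u : ℂ => 1 / 2 + Complex.I * u)
      ((fun u : ℂ => 1 / 2 + Complex.I * u) ⁻¹'
        ((Set.Icc (0 : ℝ) 1 ×ℂ Set.Icc a b) ∩ {s : ℂ | riemannZeta s = 0})) := by
    intro x _ y _ h
    have h' : Complex.I * x = Complex.I * y := by simpa using h
    exact mul_left_cancel₀ Complex.I_ne_zero h'
  refine (hK.preimage hinj).subset ?_
  rintro u ⟨h0, h1, h2⟩
  have hz : riemannXi (1 / 2 + Complex.I * u) = 0 := h0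
  obtain ⟨hζ, hre0, hre1⟩ := (riemannXi_eq_zero_iff_holds (1 / 2 + Complex.I * u)).1 hz
  refine ⟨Complex.mem_reProdIm.2 ⟨⟨hre0.le, hre1.le⟩, ?_⟩, hζ⟩
  simp only [Set.mem_Icc, Complex.add_im, Complex.mul_im, Complex.I_re, Complex.I_im,
    Complex.div_im, Complex.one_im]
  norm_num
  exact ⟨h1, h2⟩

section Dictionary

open Complex

/-- The ζ-side window with ordinates in `(a, b]` (each zero once; weights `riemannZetaZeroOrder`). -/
def zetaWindow (a b : ℝ) : Set ℂ :=
  {ρ : ℂ | riemannZeta ρ = 0 ∧ 0 ≤ ρ.re ∧ ρ.re ≤ 1 ∧ a < ρ.im ∧ ρ.im ≤ b}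

/-- For `0 ≤ a ≤ b` the zero box up to height `b` is the box up to `a` together with the window `(a, b]`. -/
theorem zetaZeroBox_eq_union {a b : ℝ} (ha : 0 ≤ a) (hab : a ≤ b) :
    zetaZeroBox 0 b = zetaZeroBox 0 a ∪ zetaWindow a b := by
  ext ρ
  simp only [zetaZeroBox, zetaWindow, Set.mem_union, Set.mem_setOf_eq]
  constructor
  · rintro ⟨h0, h1, h2, h3, h4⟩
    by_cases h : ρ.im ≤ a
    · exact Or.inl ⟨h0, h1, h2, h3, h⟩
    · exact Or.inr ⟨h0, h1, h2, lt_of_not_ge h, h4⟩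
  · rintro (⟨h0, h1, h2, h3, h4⟩ | ⟨h0, h1, h2, h3, h4⟩)
    · exact ⟨h0, h1, h2, h3, h4.trans hab⟩
    · exact ⟨h0, h1, h2, by linarith, h4⟩

/-- The window `(a, b]` (`0 ≤ a`) lies inside the zero box up to `b`. -/
theorem zetaWindow_subset_box {a b : ℝ} (ha : 0 ≤ a) : zetaWindow a b ⊆ zetaZeroBox 0 b := by
  rintro ρ ⟨h0, h1, h2, h3, h4⟩
  exact ⟨h0, h1, h2, by linarith, h4⟩

/-- The window `(a, b]` of zeta zeros is a finite set (`0 ≤ a`). -/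
theorem zetaWindow_finite {a b : ℝ} (ha : 0 ≤ a) : (zetaWindow a b).Finite :=
  (zetaZeroBox_finite 0 b).subset (zetaWindow_subset_box ha)

/-- The zero box up to `a` and the window `(a, b]` are disjoint. -/
theorem disjoint_box_window (a b : ℝ) : Disjoint (zetaZeroBox 0 a) (zetaWindow a b) := by
  refine Set.disjoint_left.2 fun ρ h1 h2 => ?_
  obtain ⟨-, -, -, -, h⟩ := h1
  obtain ⟨-, -, -, h', -⟩ := h2
  linarith

/-- The ℤ-valued multiplicity sum over a box is nonnegative. -/
theorem boxSum_nonneg (T : ℝ) : 0 ≤ ∑ᶠ ρ ∈ zetaZeroBox 0 T, riemannZetaZeroOrder ρ := by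
  rw [finsum_mem_def]
  refine finsum_nonneg fun ρ => ?_
  by_cases h : ρ ∈ zetaZeroBox 0 T
  · rw [Set.indicator_of_mem h]; exact riemannZetaZeroOrder_nonneg_of_mem_zetaZeroBox h
  · rw [Set.indicator_of_notMem h]

/-- The multiplicity sum over a window is nonnegative. -/
theorem windowSum_nonneg {a b : ℝ} (ha : 0 ≤ a) : 0 ≤ ∑ᶠ ρ ∈ zetaWindow a b, riemannZetaZeroOrder ρ := by
  rw [finsum_mem_def]
  refine finsum_nonneg fun ρ => ?_
  by_cases h : ρ ∈ zetaWindow a b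
  · rw [Set.indicator_of_mem h]
    exact riemannZetaZeroOrder_nonneg_of_mem_zetaZeroBox (zetaWindow_subset_box ha h)
  · rw [Set.indicator_of_notMem h]

/-- `N(b) − N(a)` is the ℤ-window sum, cast to `ℝ`. -/
theorem count_sub_count_eq_windowSum {a b : ℝ} (ha : 0 ≤ a) (hab : a ≤ b) :
    (zetaZeroCount b : ℝ) - zetaZeroCount a = ((∑ᶠ ρ ∈ zetaWindow a b, riemannZetaZeroOrder ρ : ℤ) : ℝ) := by
  have hb : (∑ᶠ ρ ∈ zetaZeroBox 0 b, riemannZetaZeroOrder ρ) =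
      (∑ᶠ ρ ∈ zetaZeroBox 0 a, riemannZetaZeroOrder ρ) + ∑ᶠ ρ ∈ zetaWindow a b, riemannZetaZeroOrder ρ := by
    rw [zetaZeroBox_eq_union ha hab]
    exact finsum_mem_union (disjoint_box_window a b) (zetaZeroBox_finite 0 a) (zetaWindow_finite ha)
  have e1 : (zetaZeroCount b : ℤ) = ∑ᶠ ρ ∈ zetaZeroBox 0 b, riemannZetaZeroOrder ρ := by
    show (((∑ᶠ ρ ∈ zetaZeroBox 0 b, riemannZetaZeroOrder ρ).toNat : ℕ) : ℤ) = _
    exact Int.toNat_of_nonneg (boxSum_nonneg b)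
  have e2 : (zetaZeroCount a : ℤ) = ∑ᶠ ρ ∈ zetaZeroBox 0 a, riemannZetaZeroOrder ρ := by
    show (((∑ᶠ ρ ∈ zetaZeroBox 0 a, riemannZetaZeroOrder ρ).toNat : ℕ) : ℤ) = _
    exact Int.toNat_of_nonneg (boxSum_nonneg a)
  have e3 : ((zetaZeroCount b : ℤ) : ℝ) - ((zetaZeroCount a : ℤ) : ℝ) =
      ((∑ᶠ ρ ∈ zetaWindow a b, riemannZetaZeroOrder ρ : ℤ) : ℝ) := by
    rw [e1, e2, hb]; push_cast; ring
  simpa using e3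

/-- ORDER TRANSPORT along `u ↦ 1/2 + I·u` (C3 `L1a`, l.4191, re-proved verbatim). -/
theorem analyticOrderAt_xiUpper (u : ℂ) :
    analyticOrderAt riemannXiUpper u = analyticOrderAt riemannXi (1 / 2 + I * u) := by
  have hcomp : riemannXiUpper = riemannXi ∘ (fun z : ℂ ↦ 1 / 2 + I * z) := by
    funext z; rfl
  have hg : AnalyticAt ℂ (fun z : ℂ ↦ 1 / 2 + I * z) u :=
    analyticAt_const.add (analyticAt_const.mul analyticAt_id)
  have hd : HasDerivAt (fun z : ℂ ↦ 1 / 2 + I * z) I u := by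
    simpa using ((hasDerivAt_id u).const_mul I).const_add (1 / 2 : ℂ)
  have hg' : deriv (fun z : ℂ ↦ 1 / 2 + I * z) u ≠ 0 := by
    rw [hd.deriv]; exact I_ne_zero
  rw [hcomp, analyticOrderAt_comp_of_deriv_ne_zero hg hg']

/-- WEIGHT DICTIONARY at a zero in the strip: `(analyticOrderAt Ξ u).toNat = riemannZetaZeroOrder (1/2 + I u)` (C3 `L1b` ∘ `L1a`). -/
theorem xiOrd_eq_zetaOrder {u : ℂ} (h0 : 0 < (1 / 2 + I * u).re) (h1 : (1 / 2 + I * u).re < 1) :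
    xiOrd u = (riemannZetaZeroOrder (1 / 2 + I * u) : ℝ) := by
  unfold xiOrd
  rw [analyticOrderAt_xiUpper, SuzukiUncertainty.riemannZetaZeroOrder_eq_analyticOrderNatAt_riemannXi h0 h1]
  push_cast
  rfl

/-- **THE COUNTING DICTIONARY, PROVED**: `Σᶠ_{Ξ u = 0, a < Re u ≤ b} mult_Ξ(u) = N(b) − N(a)` for `0 ≤ a ≤ b`. -/
theorem xiDictHalfOpen_holds : XiDictHalfOpen := by
  intro a b ha hab
  rw [count_sub_count_eq_windowSum ha hab]
  have hmap := (Int.castAddHom ℝ).map_finsum_mem (fun ρ => riemannZetaZeroOrder ρ) (zetaWindow_finite (b := b) ha)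
  simp only [Int.coe_castAddHom] at hmap
  rw [hmap]
  -- bijection u ↦ 1/2 + I u from the Ξ-window onto the ζ-window
  refine finsum_mem_eq_of_bijOn (fun u : ℂ => 1 / 2 + I * u) ⟨?_, ?_, ?_⟩ ?_
  · -- MapsTo
    rintro u ⟨hz, h1, h2⟩
    have hz' : riemannXi (1 / 2 + I * u) = 0 := hz
    obtain ⟨hζ, hr0, hr1⟩ := (riemannXi_eq_zero_iff_holds (1 / 2 + I * u)).1 hz'
    refine ⟨hζ, hr0.le, hr1.le, ?_, ?_⟩ <;> simp <;> assumption
  · -- InjOn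
    intro x _ y _ h
    have h' : I * x = I * y := by simpa using h
    exact mul_left_cancel₀ I_ne_zero h'
  · -- SurjOn
    rintro ρ ⟨hζ, hr0, hr1, h3, h4⟩
    have hmem : ρ ∈ zetaZeroBox 0 b := ⟨hζ, hr0, hr1, by linarith, h4⟩
    obtain ⟨hζ', hs0, hs1⟩ := mem_riemannZetaNontrivialZeros_iff_holds.1
      (zetaZeroBox_subset_riemannZetaNontrivialZeros 0 b hmem)
    refine ⟨-I * (ρ - 1 / 2), ⟨?_, ?_, ?_⟩, ?_⟩
    · show riemannXi (1 / 2 + I * (-I * (ρ - 1 / 2))) = 0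
      have e : 1 / 2 + I * (-I * (ρ - 1 / 2)) = ρ := by
        rw [← mul_assoc, mul_neg, I_mul_I, neg_neg, one_mul]; ring
      rw [e]
      exact (riemannXi_eq_zero_iff_holds ρ).2 ⟨hζ', hs0, hs1⟩
    · simp; exact h3
    · simp; exact h4
    · show 1 / 2 + I * (-I * (ρ - 1 / 2)) = ρ
      rw [← mul_assoc, mul_neg, I_mul_I, neg_neg, one_mul]; ring
  · -- weights
    rintro u ⟨hz, h1, h2⟩
    have hz' : riemannXi (1 / 2 + I * u) = 0 := hz
    obtain ⟨hζ, hr0, hr1⟩ := (riemannXi_eq_zero_iff_holds (1 / 2 + I * u)).1 hz'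
    exact xiOrd_eq_zetaOrder hr0 hr1

/-- The `Ξ`-zeros `u` with `a < Re u ≤ b` form a finite set. -/
theorem xiZerosHalfOpen_finite (a b : ℝ) :
    {u : ℂ | riemannXiUpper u = 0 ∧ a < u.re ∧ u.re ≤ b}.Finite :=
  (xiZerosWindowFinite_holds a b).subset fun _ ⟨h0, h1, h2⟩ => ⟨h0, h1.le, h2⟩

/-- `zetaZeroCount` is monotone: `N(a) ≤ N(b)` for `0 ≤ a ≤ b`. -/
theorem zetaZeroCount_mono {a b : ℝ} (ha : 0 ≤ a) (hab : a ≤ b) : zetaZeroCount a ≤ zetaZeroCount b := by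
  have h := count_sub_count_eq_windowSum ha hab
  have h0 : (0 : ℝ) ≤ ((∑ᶠ ρ ∈ zetaWindow a b, riemannZetaZeroOrder ρ : ℤ) : ℝ) := by
    exact_mod_cast windowSum_nonneg (b := b) ha
  exact_mod_cast (show (zetaZeroCount a : ℝ) ≤ zetaZeroCount b by linarith)

/-- **C3 `stub_L1c` (l.4191) exactly as typed there, PROVED.** -/
theorem stub_L1c_holds {a b : ℝ} (ha : 0 ≤ a) (hab : a ≤ b) :
    (∑ᶠ u ∈ {u : ℂ | riemannXiUpper u = 0 ∧ a < u.re ∧ u.re ≤ b}, (analyticOrderAt riemannXiUpper u).toNat)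
      = zetaZeroCount b - zetaZeroCount a := by
  have hR := xiDictHalfOpen_holds a b ha hab
  have hmap := (Nat.castAddMonoidHom ℝ).map_finsum_mem (fun u => (analyticOrderAt riemannXiUpper u).toNat)
    (xiZerosHalfOpen_finite a b)
  simp only [Nat.coe_castAddMonoidHom] at hmap
  -- hmap : ((∑ᶠ … (ℕ)) : ℝ) = ∑ᶠ …, ((…).toNat : ℝ) = Σᶠ xiOrd
  have e : (((∑ᶠ u ∈ {u : ℂ | riemannXiUpper u = 0 ∧ a < u.re ∧ u.re ≤ b},
      (analyticOrderAt riemannXiUpper u).toNat : ℕ)) : ℝ) = (zetaZeroCount b : ℝ) - zetaZeroCount a := by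
    rw [hmap]; exact hR
  have hle := zetaZeroCount_mono ha hab
  have e' : (((∑ᶠ u ∈ {u : ℂ | riemannXiUpper u = 0 ∧ a < u.re ∧ u.re ≤ b},
      (analyticOrderAt riemannXiUpper u).toNat : ℕ)) : ℝ) = ((zetaZeroCount b - zetaZeroCount a : ℕ) : ℝ) := by
    rw [e, Nat.cast_sub hle]
  exact_mod_cast e'

end Dictionary

end Summit.RiemannHypothesis.RiemannHypothesis.Theorems.Splittings.EarlyAppointmentsXiZetaDictionary
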